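import Mathlib.Analysis.SpecialFunctions.Pow.Real
import Mathlib.Analysis.SpecialFunctions.Pow.Asymptotics
import Mathlib.Analysis.SpecialFunctions.Log.Basic
import Mathlib.Order.Filter.AtTopBot.Basic
import HarnessLib

/-!
# Roy's small value estimate for `𝔾ₐ × 𝔾ₘ` — an elementary asymptotic toolkit ("if `D` is large enough")

Topic `Literature/NumberTheory/Transcendental`. Part of the formalisation of the proof of Roy 2013,
Theorem 1.1 (named fact `roy2013_thm_1_1`, `RoySmallValueEstimates.lean`). Source: D. Roy,
*A small value estimate for `𝔾ₐ × 𝔾ₘ`*, Mathematika 59 (2013) 333–363 = arXiv:1301.0663, §7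
(pp. 18–19 of the arXiv text), passim:

> [...] `= exp((1+o(1))D^β)` [...] `= exp(−(1−o(1))D^ν)` [...] assuming that `D` is sufficiently
> large [...] if `D` is large enough (because `β > τ ≥ 1`) [...]

Every "`D` large enough" of §7 compares finitely many quantities of the shape `C D^a (log D)^n`
with a power `D^b`, `b > a`. This file proves the one lemma needed to discharge them
(`eventually_mul_rpow_mul_log_pow_le`: `C x^a (log x)^n ≤ x^b` for `x ≫ 0`, from
`Real.log_le_rpow_div`), its version along the natural numbers, and a few elementary bounds used
to bring the side conditions into that shape (`Nat.floor` versus its argument, binomial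
coefficients). Everything is proved; no definitions, no named facts.

## References

* [Roy2013] D. Roy, *A small value estimate for 𝔾ₐ × 𝔾ₘ*, Mathematika 59 (2013), 333–363
  (arXiv:1301.0663), §7.
-/

noncomputable section

open Filter Real

namespace Literature.NumberTheory.Transcendental

namespace Roy2013

/-! ### The comparison lemma -/

/-- **`C x^a (log x)^n ≤ x^b` for all large `x`, when `a < b`.** [folklore] -/
theorem eventually_mul_rpow_mul_log_pow_le (a b C : ℝ) (n : ℕ) (hab : a < b) :
    ∀ᶠ x : ℝ in atTop, C * x ^ a * Real.log x ^ n ≤ x ^ b := by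
  -- the exponent gap
  set ε : ℝ := (b - a) / (2 * (n + 1)) with hε
  have hn1 : (0 : ℝ) < n + 1 := by positivity
  have hε0 : 0 < ε := by rw [hε]; exact div_pos (by linarith) (by positivity)
  have hnε : n * ε ≤ (b - a) / 2 := by
    rw [hε, mul_div_assoc', div_le_div_iff₀ (by positivity) (by positivity)]
    nlinarith
  have hgap : 0 < b - a - n * ε := by linarith
  -- the threshold: `x ≥ 1` and `x^{b − a − nε} ≥ max C 0 / ε^n`
  have h1 : ∀ᶠ x : ℝ in atTop, 1 ≤ x := eventually_ge_atTop 1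
  have h2 : ∀ᶠ x : ℝ in atTop, max C 0 / ε ^ n ≤ x ^ (b - a - n * ε) :=
    (tendsto_rpow_atTop hgap).eventually_ge_atTop _
  filter_upwards [h1, h2] with x hx1 hx2
  have hx0 : 0 < x := by linarith
  have hlog0 : 0 ≤ Real.log x := Real.log_nonneg hx1
  -- `(log x)^n ≤ x^{nε} / ε^n`
  have hlog : Real.log x ^ n ≤ x ^ (n * ε) / ε ^ n := by
    have h3 : Real.log x ≤ x ^ ε / ε := Real.log_le_rpow_div hx0.le hε0
    calc Real.log x ^ n ≤ (x ^ ε / ε) ^ n := pow_le_pow_left₀ hlog0 h3 n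
      _ = x ^ (n * ε) / ε ^ n := by
          rw [div_pow, ← Real.rpow_natCast (x ^ ε) n, ← Real.rpow_mul hx0.le, mul_comm]
  -- the case `C ≤ 0` is trivial
  rcases le_or_gt C 0 with hC | hC
  · have : C * x ^ a * Real.log x ^ n ≤ 0 :=
      mul_nonpos_of_nonpos_of_nonneg (mul_nonpos_of_nonpos_of_nonneg hC (by positivity))
        (pow_nonneg hlog0 n)
    exact this.trans (by positivity)
  · have hmax : max C 0 = C := max_eq_left hC.le
    rw [hmax] at hx2
    calc C * x ^ a * Real.log x ^ n ≤ C * x ^ a * (x ^ (n * ε) / ε ^ n) :=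
          mul_le_mul_of_nonneg_left hlog (by positivity)
      _ = C / ε ^ n * x ^ (a + n * ε) := by rw [Real.rpow_add hx0]; ring
      _ ≤ x ^ (b - a - n * ε) * x ^ (a + n * ε) :=
          mul_le_mul_of_nonneg_right hx2 (by positivity)
      _ = x ^ b := by rw [← Real.rpow_add hx0]; congr 1; ring

/-- The same along the natural numbers. [folklore] -/
theorem eventually_nat_mul_rpow_mul_log_pow_le (a b C : ℝ) (n : ℕ) (hab : a < b) :
    ∀ᶠ E : ℕ in atTop, C * (E : ℝ) ^ a * Real.log E ^ n ≤ (E : ℝ) ^ b :=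
  tendsto_natCast_atTop_atTop.eventually (eventually_mul_rpow_mul_log_pow_le a b C n hab)

/-- Variant with a positive weight on the right: `C x^a (log x)^n ≤ c x^b` eventually (`c > 0`).
[folklore] -/
theorem eventually_nat_mul_rpow_mul_log_pow_le' (a b C : ℝ) (n : ℕ) {c : ℝ} (hc : 0 < c)
    (hab : a < b) : ∀ᶠ E : ℕ in atTop, C * (E : ℝ) ^ a * Real.log E ^ n ≤ c * (E : ℝ) ^ b := by
  filter_upwards [eventually_nat_mul_rpow_mul_log_pow_le a b (C / c) n hab] with E hE
  have := mul_le_mul_of_nonneg_left hE hc.le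
  calc C * (E : ℝ) ^ a * Real.log E ^ n = c * (C / c * (E : ℝ) ^ a * Real.log E ^ n) := by
        field_simp
    _ ≤ c * (E : ℝ) ^ b := this

/-! ### Elementary bounds -/

/-- `y ≤ 2⌊y⌋₊` for `y ≥ 2`. [folklore] -/
theorem le_two_mul_floor {y : ℝ} (hy : 2 ≤ y) : y ≤ 2 * ⌊y⌋₊ := by
  have h1 : (⌊y⌋₊ : ℝ) > y - 1 := Nat.lt_floor_add_one y |> fun h => by linarith
  linarith

/-- `binom(3E+2, 2) ≤ 10 E²` for `E ≥ 1`. [folklore] -/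
theorem choose_three_le {E : ℕ} (hE : 1 ≤ E) : ((3 * E + 2).choose 2 : ℝ) ≤ 10 * (E : ℝ) ^ 2 := by
  have h1 : (3 * E + 2).choose 2 = (3 * E + 2) * (3 * E + 1) / 2 := Nat.choose_two_right _
  have h2 : (3 * E + 2) * (3 * E + 1) / 2 ≤ 10 * E ^ 2 := by
    have : (3 * E + 2) * (3 * E + 1) ≤ 20 * E ^ 2 := by nlinarith
    omega
  rw [h1]; exact_mod_cast h2

/-- `binom(2E+2, 2) ≤ 5 E²` for `E ≥ 2`. [folklore] -/
theorem choose_two_le {E : ℕ} (hE : 2 ≤ E) : ((2 * E + 2).choose 2 : ℝ) ≤ 5 * (E : ℝ) ^ 2 := by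
  have h1 : (2 * E + 2).choose 2 = (2 * E + 2) * (2 * E + 1) / 2 := Nat.choose_two_right _
  have h2 : (2 * E + 2) * (2 * E + 1) / 2 ≤ 5 * E ^ 2 := by
    have : (2 * E + 2) * (2 * E + 1) ≤ 10 * E ^ 2 := by nlinarith
    omega
  rw [h1]; exact_mod_cast h2

end Roy2013

end Literature.NumberTheory.Transcendental
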